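import Summits.BirchSwinnertonDyer.BirchSwinnertonDyer.Theorems.ByReductionTypeAtTwoAdditiveInertDoorExact
import HarnessLib

/-!
# Route `ByReductionTypeAtTwo` (rung K4), crux `AdditiveRankZeroAtTwo` (item
# stmt-BirchSwinnertonDyer-19098), DEFECT-`≥ 3` sub-class: the inert pair door with the LOWER halves —
# over an inert quadratic field the two halves of BSD₂ are INTERCHANGEABLE, and per class the upper
# half (Euler systems at `p = 2`) can be replaced by CERTIFIED lower halves (seat `bsd-2adic-addL2x`, GEN 2)

HONEST FRAMING (cell `bsd-2adic`, run/shared/lean/pub/bsd-2adic/, HUMAN RULINGS D-0036/D-0074):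
theorems only; NO new definition; the displayed PRINT inputs are Gross–Zagier–Kolyvagin (`hGZK`),
modularity (`hmod`), Milne 1972 Thm. 1 in Dokchitser–Dokchitser's any-model currency (`hMilneC`) and
Murty–Murty 1997 Ch. 6 Thm. 1.2 (`hMM`, p528043, D-audit hMM PASS); nothing else asserted; no class
closed; nothing booked; BSD is not proved by any of this. PARTITION (D-0054): X5@2 ADDITIVE,
defect-`≥ 3` sub-class (B1·O1; 1 382 of the 1 945 book230 classes: `C₃` 454 + `C₆` 147 + `C₄` 18 +
`Q₈` 189 + `SL₂(𝔽₃)` 574) × p = 2 — types-the-object-of; closes none.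

WHAT THIS FILE ADDS to the GEN 0 exactness certificate (`…AdditiveInertDoorExact.lean`, p530479:
granted PRINT, BSD₂ ∀-closed on the sub-class ⟺ `hU3 ∧ hKC`, with `hU3` = the UPPER halves
`ord₂ #Ш ≤ ord₂ #Ш_an` — lens L1, Kato Astérisque 295 Thm. 14.5 (3) / 13.4 (3), printed «Assume p ≠ 2»;
and `hKC` = the `2`-part of BSD over every admissible INERT quadratic field on the canonical model).
The identity (★) `AdditivePotMult.shaAnOverC_mul_eq` says that the defects
`def(X) = ord_p #Ш_an(X) − ord_p #Ш(X)` of `W`, of its twist `Wd = W^{(d_K)}` and of any `K`-model `V`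
of `W_K` satisfy `def(V) = def(W) + def(Wd)`; GEN 0 used `def(W), def(Wd) ≥ 0` (two UPPER halves);
this file uses `def(W), def(Wd) ≤ 0` (two LOWER halves, `Typed.MissingLowerBoundAt`) — the SAME
squeeze from the other side:
* §1 `missingPPartAt_pair_of_overC_of_lower_lower` (any `p`, any `K`-model) and its `p = 2`
  canonical-model form `bsdp_two_pair_of_overKC_of_lower_lower`; the mixed form
  `bsdp_two_pair_of_overKC_of_lower_of_shaAn_twist` (a value `#Ш_an(Wd) = q_d` with `ord₂ q_d ≤ 0` —
  e.g. `#Ш_an(Wd)` ODD — is a lower half for free, cf. the tree's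
  `Additive.N10.missingLowerBoundAt_of_padicValRat_le_zero`).
* §2 the ∀-door `additiveDefectAtTwo_of_lower_of_overKC_of_murtyMurty` (`hL3 ∧ hKC` + PRINT ⟹ BSD₂ on
  the sub-class, `hL3` = the LOWER half `ord₂ #Ш_an ≤ ord₂ #Ш` on the sub-class) and the second
  exactness certificate `additiveDefectAtTwo_iff_lower_and_overKC_of_murtyMurty`; hence
  `upper_iff_lower_of_overKC_of_murtyMurty`: GRANTED `hKC` (+ PRINT), the two ∀-halves `hU3` and `hL3`
  are EQUIVALENT on the sub-class (each is then equivalent to BSD₂ there).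
* §3 crux level: `additiveRankZeroAtTwo_iff_quadratic_and_lower_and_overKC_of_murtyMurty` and the crux
  BY NAME from (quadratic part, `hL3`, `hKC`) + PRINT.
* §4 the PER-CLASS door shape `bsdp_two_of_overKC_at_of_lower_certificates`: for ONE curve `W` of the
  sub-class, ONE explicit inert `K = ℚ(√D)` with `L(W^{(D)},1) ≠ 0` and a minimal model `Wd` of the
  twist, BSD₂(W) ∧ BSD₂(Wd) follow from PRINT + the two LOWER-half CERTIFICATES `hlow : MissingLowerBoundAt
  W 2`, `hlowd : MissingLowerBoundAt Wd 2` (Cassels–Tate / `2^k`-descent outputs: engines CT-2 / CT42-2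
  / F / G of the cell, two-engine on every X5 class for `W`; for `Wd` trivial whenever `#Ш_an(Wd)` is
  odd) + exactly ONE research binder, `hK : MissingPPartOverCAt (W.baseChange K) 2` at that `K`.
  Reading: per class, the Euler-system half `hU3` (for `W` AND for the Murty–Murty twist of ineffective
  size) DISAPPEARS from the defect-`≥ 3` door; what is displayed beyond print and certificates is hKC at
  a single small inert field — the W-addL2x-1′ object of the GEN 0 verdict, and nothing else.

Why the lower halves are the right currency at `p = 2` (numbers, HOME/addL2x GEN 2 memo): the cell's
engines certify `ord₂ #Ш ≥ 4` (CT-2, «Ш[2] ⊂ 2Ш[4]», two-engine on every X5 class) and `≥ 6` (CT42-2,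
84 + 3 additive classes), i.e. `hlow` is a CERTIFICATE on 1 380/1 380 rank-0 classes of the block,
whereas no instrument and no print gives `hU3` at an additive `2`.

References: [Milne1972ArithmeticAV] §1 Thm. 1 (through [DokchitserDokchitserAnnals2010] §2.1);
[MurtyMurty1997] Ch. 6 Thms. 1.1–1.2; [Miller2011LMS] Def. 1.1 (the currency `MissingLowerBoundAt`).
-/

set_option autoImplicit false
-- the Theorems namespace of this sub repeats the summit name by design (D-0017 nested layout)
set_option linter.dupNamespace false

noncomputable section

open scoped Classical

open WeierstrassCurve Literature.NumberTheory.EllipticCurves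
  Literature.NumberTheory.EllipticCurves.Rank1Residual
  Literature.NumberTheory.EllipticCurves.Rank1Residual.Typed
  Literature.NumberTheory.QuadraticFields
  Summit.BirchSwinnertonDyer.Rank1Residual.AdditivePotMult
  Summit.BirchSwinnertonDyer.Rank1Residual.X5.AddTwoL2
  Summit.BirchSwinnertonDyer.BirchSwinnertonDyer.Theses.ByReductionTypeAtTwo

namespace Summit.BirchSwinnertonDyer.BirchSwinnertonDyer.Theorems

/-! ## §1. The pair theorem with LOWER halves (any prime, any `K`-model), and at `p = 2` on the canonical model -/

section Pair

variable (W : WeierstrassCurve ℚ) [W.IsElliptic] (p : ℕ) [Fact p.Prime]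
  (K : Type) [Field K] [NumberField K]
  (Wd : WeierstrassCurve ℚ) [Wd.IsElliptic] (V : WeierstrassCurve K) [V.IsElliptic]

/-- **Pair theorem with LOWER halves on an arbitrary `K`-model (any prime `p`, any quadratic `K`).**
Under the hypotheses of (★) `AdditivePotMult.shaAnOverC_mul_eq` (modularity, `[K:ℚ] = 2`, `Wd` a model
of `W^{(d_K)}`, `V` any `K`-model of `W_K`, the three `Ш` finite, the model-free Weil-restriction
identity `hWR` with Dokchitser–Dokchitser's `C(V)`): if the `p`-part of BSD holds for `V` over `K`
(`MissingPPartOverCAt V p`) and the LOWER halves `ord_p #Ш_an ≤ ord_p #Ш` hold for `W` and `Wd` over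
`ℚ`, then the `p`-part holds for BOTH `W` and `Wd`: (★) gives `def(V) = def(W) + def(Wd)` for the
defects `def(X) = ord_p #Ш_an(X) − ord_p #Ш(X)`, and `def(V) = 0`, `def(W), def(Wd) ≤ 0` force both to
vanish. The mirror image of `missingPPartAt_pair_of_overC_of_upper_upper` (p530479). No parity hypothesis.
[cite: Milne1972ArithmeticAV, §1 Thm. 1 (through DokchitserDokchitserAnnals2010 §2.1)] -/
theorem missingPPartAt_pair_of_overC_of_lower_lower (hmod : hasEntireLFunction_rat)
    (h2 : Module.finrank ℚ K = 2)
    (hWd : ∃ C : VariableChange ℚ, C • W.quadraticTwist (NumberField.discr K : ℚ) = Wd)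
    (hV : ∃ C : VariableChange K, C • W.baseChange K = V)
    (hshaW : W.ShaFinite) (hshaD : Wd.ShaFinite) (hshaK : V.ShaFinite)
    (hWR : (V.shaOrder : ℝ) * V.regulator * V.bsdPeriod * (V.modifiedTamagawaProduct : ℝ) /
        (V.torsionOrder : ℝ) ^ 2 = W.bsdRHS * Wd.bsdRHS)
    (hK : MissingPPartOverCAt V p) (hl : MissingLowerBoundAt W p)
    (hld : MissingLowerBoundAt Wd p) : MissingPPartAt W p ∧ MissingPPartAt Wd p := by
  obtain ⟨q', hq', hv'⟩ := hK
  obtain ⟨q, hq, hle⟩ := hl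
  obtain ⟨qd, hqd, hled⟩ := hld
  have hstar := shaAnOverC_mul_eq W K Wd V hmod h2 hWd hV hshaW hshaD hWR
  have hsW : W.shaOrder ≠ 0 := (W.shaOrder_pos hshaW).ne'
  have hsD : Wd.shaOrder ≠ 0 := (Wd.shaOrder_pos hshaD).ne'
  have hsK : V.shaOrder ≠ 0 := (V.shaOrder_pos hshaK).ne'
  have hq0 : q ≠ 0 := by
    intro h0; apply shaAn_ne_zero W hmod; rw [hq, h0, Rat.cast_zero]
  have hqd0 : qd ≠ 0 := by
    intro h0; apply shaAn_ne_zero Wd hmod; rw [hqd, h0, Rat.cast_zero]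
  -- (★) in `ℚ`
  have hQ : q' * W.shaOrder * Wd.shaOrder = q * qd * V.shaOrder := by
    have h : ((q' * W.shaOrder * Wd.shaOrder : ℚ) : ℂ) = ((q * qd * V.shaOrder : ℚ) : ℂ) := by
      push_cast
      rw [← hq, ← hq', ← hqd]
      exact hstar
    exact_mod_cast h
  have hsWq : (W.shaOrder : ℚ) ≠ 0 := by exact_mod_cast hsW
  have hsDq : (Wd.shaOrder : ℚ) ≠ 0 := by exact_mod_cast hsD
  have hsKq : (V.shaOrder : ℚ) ≠ 0 := by exact_mod_cast hsK
  have hq'0 : q' ≠ 0 := by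
    intro h0
    rw [h0, zero_mul, zero_mul] at hQ
    exact mul_ne_zero (mul_ne_zero hq0 hqd0) hsKq hQ.symm
  have hv := congrArg (padicValRat p) hQ
  rw [padicValRat.mul (mul_ne_zero hq'0 hsWq) hsDq, padicValRat.mul hq'0 hsWq,
    padicValRat.mul (mul_ne_zero hq0 hqd0) hsKq, padicValRat.mul hq0 hqd0,
    padicValRat.of_nat, padicValRat.of_nat, padicValRat.of_nat] at hv
  refine ⟨⟨q, hq, ?_⟩, ⟨qd, hqd, ?_⟩⟩
  · push_cast at hv hle hled hv' ⊢; linarith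
  · push_cast at hv hle hled hv' ⊢; linarith

/-- **`p = 2` on the canonical model, Milne and GZK discharged: `BSD(W,2) ∧ BSD(Wd,2)` from the
`2`-part over `K` on `W.baseChange K` and the two LOWER halves.** For `W/ℚ`, `Wd` globally minimal of
analytic rank `≤ 1`, `K` any quadratic field: `MissingPPartOverCAt (W.baseChange K) 2 ∧
MissingLowerBoundAt W 2 ∧ MissingLowerBoundAt Wd 2 ⟹ BSDp W 2 ∧ BSDp Wd 2`. Mirror image of
`bsdp_two_pair_of_overKC_of_upper_upper` (p530479).
[cite: Milne1972ArithmeticAV, §1 Thm. 1 (through DokchitserDokchitserAnnals2010 §2.1)] -/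
theorem bsdp_two_pair_of_overKC_of_lower_lower [W.IsGloballyMinimal] [Wd.IsGloballyMinimal]
    (hGZK : rank_eq_analyticRank_of_analyticRank_le_one) (hmod : hasEntireLFunction_rat)
    (hMilneC : Milne1972.bsdQuotient_baseChange_quadratic_anyModel)
    (hr : W.analyticRank ≤ 1) (h2 : Module.finrank ℚ K = 2)
    (hWd : ∃ C : VariableChange ℚ, C • W.quadraticTwist (NumberField.discr K : ℚ) = Wd)
    (hrd : Wd.analyticRank ≤ 1) (hK : MissingPPartOverCAt (W.baseChange K) 2)
    (hl : MissingLowerBoundAt W 2) (hld : MissingLowerBoundAt Wd 2) : BSDp W 2 ∧ BSDp Wd 2 := by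
  haveI : Fact (Nat.Prime 2) := ⟨Nat.prime_two⟩
  haveI : (W.baseChange K).IsElliptic := by rw [baseChange]; infer_instance
  have hV : ∃ C : VariableChange K, C • W.baseChange K = W.baseChange K := ⟨1, one_smul _ _⟩
  obtain ⟨-, hfinW⟩ := hGZK W hr
  obtain ⟨-, hfinD⟩ := hGZK Wd hrd
  obtain ⟨hshaK, hWR⟩ := hMilneC W K h2 Wd hWd (W.baseChange K) hV hfinW hfinD
  obtain ⟨hW, hD⟩ := missingPPartAt_pair_of_overC_of_lower_lower W 2 K Wd (W.baseChange K) hmod h2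
    hWd hV hfinW hfinD hshaK hWR hK hl hld
  exact ⟨bsdp_of_missingPPartAt W 2 hGZK hr hW, bsdp_of_missingPPartAt Wd 2 hGZK hrd hD⟩

/-- **Mixed form at `p = 2`: lower half for `W`, ODD analytic `Ш` (or any `ord₂ #Ш_an ≤ 0`) for the
twist.** `MissingPPartOverCAt (W.baseChange K) 2 ∧ MissingLowerBoundAt W 2 ∧ (#Ш(Wd)_an = q_d,
ord₂ q_d ≤ 0) ⟹ BSDp W 2 ∧ BSDp Wd 2`. The UPPER half for `W` comes for free from the product over `K`
once the twist's analytic `Ш` carries no `2`. [cite: Milne1972ArithmeticAV, §1 Thm. 1] -/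
theorem bsdp_two_pair_of_overKC_of_lower_of_shaAn_twist [W.IsGloballyMinimal] [Wd.IsGloballyMinimal]
    (hGZK : rank_eq_analyticRank_of_analyticRank_le_one) (hmod : hasEntireLFunction_rat)
    (hMilneC : Milne1972.bsdQuotient_baseChange_quadratic_anyModel)
    (hr : W.analyticRank ≤ 1) (h2 : Module.finrank ℚ K = 2)
    (hWd : ∃ C : VariableChange ℚ, C • W.quadraticTwist (NumberField.discr K : ℚ) = Wd)
    (hrd : Wd.analyticRank ≤ 1) (hK : MissingPPartOverCAt (W.baseChange K) 2)
    (hl : MissingLowerBoundAt W 2) {qd : ℚ} (hqd : shaAn Wd = (qd : ℂ))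
    (hvd : padicValRat 2 qd ≤ 0) : BSDp W 2 ∧ BSDp Wd 2 :=
  -- a non-positive valuation of `#Ш_an(Wd)` is a lower half for free (`ord₂ #Ш(Wd) ≥ 0`); the tree's
  -- `Additive.N10.missingLowerBoundAt_of_padicValRat_le_zero` says the same for the N10 rows
  bsdp_two_pair_of_overKC_of_lower_lower W K Wd hGZK hmod hMilneC hr h2 hWd hrd hK hl
    ⟨qd, hqd, hvd.trans (by exact_mod_cast Nat.zero_le _)⟩

end Pair

/-! ## §2. The ∀-door with the LOWER halves, its exactness, and `hU3 ⟺ hL3` granted `hKC` -/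

section Door

/-- **The defect-`≥ 3` sub-class through the INERT pair door with LOWER halves.** PRINT
{`hGZK`, `hmod`, `hMilneC`, `hMM` (Murty–Murty inert twist supply)} + the LOWER half on the sub-class
(`hL3`: for every non-CM `r_an = 0` `W` of defect `≥ 3`, `ord₂ #Ш_an ≤ ord₂ #Ш` — the
«Eisenstein / main-conjecture» direction; per class a Cassels–Tate / `2^k`-descent CERTIFICATE;
DISPLAYED) + the `2`-part over inert quadratic fields on the canonical model (`hKC`, as registered in
`stub_addDefectOverKC`; DISPLAYED) ⟹ BSD₂ for every non-CM analytic-rank-`0` `W` with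
`AddTwoL2.DefectAtLeastThree W`. Proof: Murty–Murty's inert `K`; a minimal model `Wd` of `W^{(d_K)}`
is non-CM, analytic rank `0` and again of defect `≥ 3`, so `hL3` applies to `W` and `Wd`; §1.
[cite: MurtyMurty1997, Ch. 6 Thm. 1.2 with the deduction of Thm. 1.1 (pp. 93–94, 96 of the text)]
[cite: Milne1972ArithmeticAV, §1 Thm. 1 (through DokchitserDokchitserAnnals2010 §2.1)] -/
theorem additiveDefectAtTwo_of_lower_of_overKC_of_murtyMurty
    (hGZK : rank_eq_analyticRank_of_analyticRank_le_one) (hmod : hasEntireLFunction_rat)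
    (hMilneC : Milne1972.bsdQuotient_baseChange_quadratic_anyModel)
    (hMM : murtyMurty_exists_twist_ne_zero_prescribedAtTwo)
    (hL3 : ∀ (W : WeierstrassCurve ℚ) [W.IsElliptic] [W.IsGloballyMinimal],
      ¬ W.HasCM → W.analyticRank = 0 → DefectAtLeastThree W → MissingLowerBoundAt W 2)
    (hKC : ∀ (W : WeierstrassCurve ℚ) [W.IsElliptic] [W.IsGloballyMinimal],
      ¬ W.HasCM → W.analyticRank = 0 → DefectAtLeastThree W →
      ∀ (K : Type) [Field K] [NumberField K], Module.finrank ℚ K = 2 → TwoInert K →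
        (W.quadraticTwist (NumberField.discr K : ℚ)).entireLFunction 1 ≠ 0 →
        MissingPPartOverCAt (W.baseChange K) 2)
    (W : WeierstrassCurve ℚ) [W.IsElliptic] [W.IsGloballyMinimal] (hcm : ¬ W.HasCM)
    (hr : W.analyticRank = 0) (hdef : DefectAtLeastThree W) : BSDp W 2 := by
  haveI : Fact (Nat.Prime 2) := ⟨Nat.prime_two⟩
  obtain ⟨K, _, _, h2, hin, hL⟩ := existsNonvanishingInertTwist_of_murtyMurty hMM W
  have hd : (NumberField.discr K : ℚ) ≠ 0 := by exact_mod_cast NumberField.discr_ne_zero K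
  haveI := W.isElliptic_quadraticTwist hd
  -- a globally minimal model `Wd` of the inert twist
  obtain ⟨C, hCmin⟩ := hasGlobalMinimalModel_rat_holds (W.quadraticTwist (NumberField.discr K : ℚ))
  haveI : (C • W.quadraticTwist (NumberField.discr K : ℚ)).IsGloballyMinimal := hCmin
  set Wd := C • W.quadraticTwist (NumberField.discr K : ℚ) with hWd_def
  have hWd : ∃ C' : VariableChange ℚ, C' • W.quadraticTwist (NumberField.discr K : ℚ) = Wd := ⟨C, rfl⟩
  have hcmd : ¬ Wd.HasCM := by
    intro h
    apply hcm
    have h1 : (W.quadraticTwist (NumberField.discr K : ℚ)).HasCM :=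
      (hasCM_iff_of_j_eq ((W.quadraticTwist (NumberField.discr K : ℚ)).variableChange_j C)).mp h
    exact (hasCM_iff_of_j_eq (W.j_quadraticTwist hd)).mp h1
  have hrd : Wd.analyticRank = 0 := by
    rw [hWd_def, analyticRank_smul]
    exact analyticRank_eq_zero_of_entireLFunction_one_ne_zero hL
  have hin4 : NumberField.discr K % 4 = 1 := by
    have h5 : NumberField.discr K % 8 = 5 := hin
    omega
  have hdefd : DefectAtLeastThree Wd :=
    defectAtLeastThree_of_smul_quadraticTwist_of_emod_four_eq_one W Wd hin4 rfl hdef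
  exact (bsdp_two_pair_of_overKC_of_lower_lower W K Wd hGZK hmod hMilneC (by omega) h2 hWd (by omega)
    (hKC W hcm hr hdef K h2 hin hL) (hL3 W hcm hr hdef) (hL3 Wd hcmd hrd hdefd)).1

/-- **Second EXACTNESS certificate on the defect-`≥ 3` sub-class.** Granted PRINT {`hGZK`, `hmod`,
`hMilneC`, `hMM`}, BSD₂ ∀-closed on the sub-class is EQUIVALENT to `hL3 ∧ hKC` (the LOWER half on the
sub-class AND the `2`-part over admissible inert quadratic fields on the canonical model). Compare the
GEN 0 certificate `additiveDefectAtTwo_iff_upper_and_overKC_of_murtyMurty` (`⟺ hU3 ∧ hKC`).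
[cite: MurtyMurty1997, Ch. 6 Thm. 1.2 with the deduction of Thm. 1.1 (pp. 93–94, 96 of the text)]
[cite: Milne1972ArithmeticAV, §1 Thm. 1 (through DokchitserDokchitserAnnals2010 §2.1)] -/
theorem additiveDefectAtTwo_iff_lower_and_overKC_of_murtyMurty
    (hGZK : rank_eq_analyticRank_of_analyticRank_le_one) (hmod : hasEntireLFunction_rat)
    (hMilneC : Milne1972.bsdQuotient_baseChange_quadratic_anyModel)
    (hMM : murtyMurty_exists_twist_ne_zero_prescribedAtTwo) :
    (∀ (W : WeierstrassCurve ℚ) [W.IsElliptic] [W.IsGloballyMinimal],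
      ¬ W.HasCM → W.analyticRank = 0 → DefectAtLeastThree W → BSDp W 2) ↔
    ((∀ (W : WeierstrassCurve ℚ) [W.IsElliptic] [W.IsGloballyMinimal],
        ¬ W.HasCM → W.analyticRank = 0 → DefectAtLeastThree W → MissingLowerBoundAt W 2) ∧
      (∀ (W : WeierstrassCurve ℚ) [W.IsElliptic] [W.IsGloballyMinimal],
        ¬ W.HasCM → W.analyticRank = 0 → DefectAtLeastThree W →
        ∀ (K : Type) [Field K] [NumberField K], Module.finrank ℚ K = 2 → TwoInert K →
          (W.quadraticTwist (NumberField.discr K : ℚ)).entireLFunction 1 ≠ 0 →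
          MissingPPartOverCAt (W.baseChange K) 2)) := by
  haveI : Fact (Nat.Prime 2) := ⟨Nat.prime_two⟩
  constructor
  · intro hB
    refine ⟨fun W _ _ hcm hr hdef => ?_, ?_⟩
    · -- BSD₂ ⇒ lower half
      obtain ⟨-, hfin⟩ := hGZK W (by rw [hr]; exact zero_le_one)
      haveI : Finite W.sha := hfin
      exact (lower_and_upper_of_missingPPartAt W 2 (missingPPartAt_of_bsdp W 2 (hB W hcm hr hdef))).1
    · -- BSD₂ on the block ⇒ hKC: the GEN 0 certificate already proves it
      exact ((additiveDefectAtTwo_iff_upper_and_overKC_of_murtyMurty hGZK hmod hMilneC hMM).mp hB).2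
  · rintro ⟨hL3, hKC⟩ W _ _ hcm hr hdef
    exact additiveDefectAtTwo_of_lower_of_overKC_of_murtyMurty hGZK hmod hMilneC hMM hL3 hKC W hcm
      hr hdef

/-- **Granted `hKC` (+ PRINT), the two ∀-halves are EQUIVALENT on the defect-`≥ 3` sub-class**:
`hU3 ⟺ hL3` — each being then equivalent to BSD₂ on the sub-class (the two exactness certificates).
Reading: over an inert quadratic field the Euler-system direction and the main-conjecture direction of
BSD₂ at the additive prime `2` are interchangeable inputs; the door may display whichever is cheaper —
per class, the LOWER half is a certificate. [cite: MurtyMurty1997, Ch. 6 Thm. 1.2]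
[cite: Milne1972ArithmeticAV, §1 Thm. 1 (through DokchitserDokchitserAnnals2010 §2.1)] -/
theorem upper_iff_lower_of_overKC_of_murtyMurty
    (hGZK : rank_eq_analyticRank_of_analyticRank_le_one) (hmod : hasEntireLFunction_rat)
    (hMilneC : Milne1972.bsdQuotient_baseChange_quadratic_anyModel)
    (hMM : murtyMurty_exists_twist_ne_zero_prescribedAtTwo)
    (hKC : ∀ (W : WeierstrassCurve ℚ) [W.IsElliptic] [W.IsGloballyMinimal],
      ¬ W.HasCM → W.analyticRank = 0 → DefectAtLeastThree W →
      ∀ (K : Type) [Field K] [NumberField K], Module.finrank ℚ K = 2 → TwoInert K →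
        (W.quadraticTwist (NumberField.discr K : ℚ)).entireLFunction 1 ≠ 0 →
        MissingPPartOverCAt (W.baseChange K) 2) :
    (∀ (W : WeierstrassCurve ℚ) [W.IsElliptic] [W.IsGloballyMinimal],
      ¬ W.HasCM → W.analyticRank = 0 → DefectAtLeastThree W → MissingUpperBoundAt W 2) ↔
    (∀ (W : WeierstrassCurve ℚ) [W.IsElliptic] [W.IsGloballyMinimal],
      ¬ W.HasCM → W.analyticRank = 0 → DefectAtLeastThree W → MissingLowerBoundAt W 2) := by
  constructor
  · intro hU3
    exact ((additiveDefectAtTwo_iff_lower_and_overKC_of_murtyMurty hGZK hmod hMilneC hMM).mp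
      ((additiveDefectAtTwo_iff_upper_and_overKC_of_murtyMurty hGZK hmod hMilneC hMM).mpr
        ⟨hU3, hKC⟩)).1
  · intro hL3
    exact ((additiveDefectAtTwo_iff_upper_and_overKC_of_murtyMurty hGZK hmod hMilneC hMM).mp
      ((additiveDefectAtTwo_iff_lower_and_overKC_of_murtyMurty hGZK hmod hMilneC hMM).mpr
        ⟨hL3, hKC⟩)).1

end Door

/-! ## §3. Crux level -/

section Crux

/-- **EXACTNESS at crux level, lower-half form.** Granted PRINT {`hGZK`, `hmod`, `hMilneC`, `hMM`},
`AdditiveRankZeroAtTwo` ⟺ (quadratic part) ∧ `hL3` ∧ `hKC`. Twin of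
`additiveRankZeroAtTwo_iff_quadratic_and_upper_and_overKC_of_murtyMurty` (p530479).
[cite: MurtyMurty1997, Ch. 6 Thm. 1.2 with the deduction of Thm. 1.1 (pp. 93–94, 96 of the text)]
[cite: Milne1972ArithmeticAV, §1 Thm. 1 (through DokchitserDokchitserAnnals2010 §2.1)] -/
theorem additiveRankZeroAtTwo_iff_quadratic_and_lower_and_overKC_of_murtyMurty
    (hGZK : rank_eq_analyticRank_of_analyticRank_le_one) (hmod : hasEntireLFunction_rat)
    (hMilneC : Milne1972.bsdQuotient_baseChange_quadratic_anyModel)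
    (hMM : murtyMurty_exists_twist_ne_zero_prescribedAtTwo) :
    Summit.BirchSwinnertonDyer.BirchSwinnertonDyer.Theses.ByReductionTypeAtTwo.AdditiveRankZeroAtTwo ↔
    ((∀ (W : WeierstrassCurve ℚ) [W.IsElliptic] [W.IsGloballyMinimal],
        ¬ W.HasCM → W.analyticRank = 0 → Addv W 2 → QuadSemistabilisable W → BSDp W 2) ∧
      (∀ (W : WeierstrassCurve ℚ) [W.IsElliptic] [W.IsGloballyMinimal],
        ¬ W.HasCM → W.analyticRank = 0 → DefectAtLeastThree W → MissingLowerBoundAt W 2) ∧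
      (∀ (W : WeierstrassCurve ℚ) [W.IsElliptic] [W.IsGloballyMinimal],
        ¬ W.HasCM → W.analyticRank = 0 → DefectAtLeastThree W →
        ∀ (K : Type) [Field K] [NumberField K], Module.finrank ℚ K = 2 → TwoInert K →
          (W.quadraticTwist (NumberField.discr K : ℚ)).entireLFunction 1 ≠ 0 →
          MissingPPartOverCAt (W.baseChange K) 2)) := by
  rw [additiveRankZeroAtTwo_iff_quadratic_and_defect,
    additiveDefectAtTwo_iff_lower_and_overKC_of_murtyMurty hGZK hmod hMilneC hMM]

/-- **The crux BY NAME from (quadratic part, `hL3`, `hKC`) + PRINT.** Honest label: `hQ`, `hL3`,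
`hKC` are DISPLAYED research objects at the ∀-level (none in print at `p = 2`); this theorem credits
nothing. [cite: MurtyMurty1997, Ch. 6 Thm. 1.2] [cite: Milne1972ArithmeticAV, §1 Thm. 1] -/
theorem additiveRankZeroAtTwo_of_quadratic_of_lower_of_overKC_of_murtyMurty
    (hGZK : rank_eq_analyticRank_of_analyticRank_le_one) (hmod : hasEntireLFunction_rat)
    (hMilneC : Milne1972.bsdQuotient_baseChange_quadratic_anyModel)
    (hMM : murtyMurty_exists_twist_ne_zero_prescribedAtTwo)
    (hQ : ∀ (W : WeierstrassCurve ℚ) [W.IsElliptic] [W.IsGloballyMinimal],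
      ¬ W.HasCM → W.analyticRank = 0 → Addv W 2 → QuadSemistabilisable W → BSDp W 2)
    (hL3 : ∀ (W : WeierstrassCurve ℚ) [W.IsElliptic] [W.IsGloballyMinimal],
      ¬ W.HasCM → W.analyticRank = 0 → DefectAtLeastThree W → MissingLowerBoundAt W 2)
    (hKC : ∀ (W : WeierstrassCurve ℚ) [W.IsElliptic] [W.IsGloballyMinimal],
      ¬ W.HasCM → W.analyticRank = 0 → DefectAtLeastThree W →
      ∀ (K : Type) [Field K] [NumberField K], Module.finrank ℚ K = 2 → TwoInert K →
        (W.quadraticTwist (NumberField.discr K : ℚ)).entireLFunction 1 ≠ 0 →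
        MissingPPartOverCAt (W.baseChange K) 2) :
    Summit.BirchSwinnertonDyer.BirchSwinnertonDyer.Theses.ByReductionTypeAtTwo.AdditiveRankZeroAtTwo :=
  (additiveRankZeroAtTwo_iff_quadratic_and_lower_and_overKC_of_murtyMurty hGZK hmod hMilneC hMM).mpr
    ⟨hQ, hL3, hKC⟩

end Crux

/-! ## §4. The per-class door shape: PRINT + two LOWER certificates + ONE research binder at ONE inert field -/

section PerClass

variable (W : WeierstrassCurve ℚ) [W.IsElliptic] [W.IsGloballyMinimal]
  (K : Type) [Field K] [NumberField K]
  (Wd : WeierstrassCurve ℚ) [Wd.IsElliptic] [Wd.IsGloballyMinimal]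

/-- **Per-class door (single research binder).** For ONE globally minimal `W` of analytic rank `≤ 1`,
ONE quadratic field `K` (for the additive defect-`≥ 3` classes: `2` inert, `d_K ≡ 5 (mod 8)`, small and
explicit) and a globally minimal model `Wd` of `W^{(d_K)}` of analytic rank `≤ 1`: PRINT {`hGZK`, `hmod`,
`hMilneC`} + the CERTIFICATES `hlow : MissingLowerBoundAt W 2` (the cell's Cassels–Tate / descent
engines) and `hlowd : MissingLowerBoundAt Wd 2` (idem; free when `#Ш_an(Wd)` is odd, next theorem) + the ONE research binder `hK : MissingPPartOverCAt (W.baseChange K) 2` (the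
`2`-part of BSD over `K` for `E_K` on the canonical model — W-addL2x-1′ at this single `K`) ⟹
`BSDp W 2 ∧ BSDp Wd 2`. No upper half, no Euler system at `p = 2`, no twist of ineffective size is
displayed. (= §1 `bsdp_two_pair_of_overKC_of_lower_lower`, restated with the per-class reading.)
[cite: Milne1972ArithmeticAV, §1 Thm. 1 (through DokchitserDokchitserAnnals2010 §2.1)] -/
theorem bsdp_two_of_overKC_at_of_lower_certificates
    (hGZK : rank_eq_analyticRank_of_analyticRank_le_one) (hmod : hasEntireLFunction_rat)
    (hMilneC : Milne1972.bsdQuotient_baseChange_quadratic_anyModel)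
    (hr : W.analyticRank ≤ 1) (h2 : Module.finrank ℚ K = 2)
    (hWd : ∃ C : VariableChange ℚ, C • W.quadraticTwist (NumberField.discr K : ℚ) = Wd)
    (hrd : Wd.analyticRank ≤ 1) (hlow : MissingLowerBoundAt W 2) (hlowd : MissingLowerBoundAt Wd 2)
    (hK : MissingPPartOverCAt (W.baseChange K) 2) : BSDp W 2 ∧ BSDp Wd 2 :=
  bsdp_two_pair_of_overKC_of_lower_lower W K Wd hGZK hmod hMilneC hr h2 hWd hrd hK hlow hlowd

/-- **Per-class door, odd-twist form**: as above with `hlowd` replaced by an exact analytic-`Ш` value of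
the twist with `ord₂ ≤ 0` (`#Ш_an(Wd)` odd). [cite: Milne1972ArithmeticAV, §1 Thm. 1] -/
theorem bsdp_two_of_overKC_at_of_lower_of_oddTwist
    (hGZK : rank_eq_analyticRank_of_analyticRank_le_one) (hmod : hasEntireLFunction_rat)
    (hMilneC : Milne1972.bsdQuotient_baseChange_quadratic_anyModel)
    (hr : W.analyticRank ≤ 1) (h2 : Module.finrank ℚ K = 2)
    (hWd : ∃ C : VariableChange ℚ, C • W.quadraticTwist (NumberField.discr K : ℚ) = Wd)
    (hrd : Wd.analyticRank ≤ 1) (hlow : MissingLowerBoundAt W 2) {qd : ℚ}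
    (hqd : shaAn Wd = (qd : ℂ)) (hvd : padicValRat 2 qd ≤ 0)
    (hK : MissingPPartOverCAt (W.baseChange K) 2) : BSDp W 2 ∧ BSDp Wd 2 :=
  bsdp_two_pair_of_overKC_of_lower_of_shaAn_twist W K Wd hGZK hmod hMilneC hr h2 hWd hrd hK hlow hqd
    hvd

end PerClass

end Summit.BirchSwinnertonDyer.BirchSwinnertonDyer.Theorems

end
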